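import Summits.QuantumFields.YangMills.Theorems.BalabanUVNodesN13Cor3AsymJunctionFullBudgetAtRecord13CoPH
import Summits.QuantumFields.YangMills.Theorems.BalabanUVNodesN11Thm2AlongSupplyChainUpperHalf

/-!
# BalabanUVNodes ∕ N13 — THE N11 → N13 EDGE END AT NODE 00's STAGE-13 RECORD WITH THE PRINTED BUDGET **AND THEOREM 2 KEYED**: p601758 §3's forty-line
# configuration-indexed Theorem-2 sentence binders `h243` ∕ `h244` REPLACED by dag-n11-w2's keyed tokens (`B14Thm2.Ineq243 ∧ Ineq244` on `sect2DataOfRecord₁₃Keyed θ P 𝒯 𝒰`,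
# resp. `B14.Thm2Printed` keyed to dag-n11-e's supply chain), the history ∕ term ∕ background of a configuration READ THROUGH THE CARRIER; chain edition with (2.48) DISCHARGED
# (Track A, DAG node N13 = [B16]; cluster K1 — K1⁷ `StabilityBAtRecordR13SepCoPH` = stmt-QuantumFields-20542, helper `--as helper`; seat `pub-ymgap-dag-n13-w2` g3, own-lineage
# successor of g2's p601758; consumer of dag-n11-w2's p605075; 2026-08-28; count-neutral)

[B16] = T. Bałaban, *Large field renormalization. II. Localization, exponentiation, and bounds for the 𝐑 operation*, Commun. Math. Phys. **122** (1989) 355–392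
[Balaban1989LargeFieldII] ((0.1), (1.72), (1.80), p. 387, p. 391); [III] = [Balaban1988Convergent] Thm 1 p. 262, Thm 2 p. 263, (2.41)–(2.50) pp. 261–264, (2.24) p. 259.
statement-level bookkeeping of a published proof with citation tags; proofs kernel-checked; nothing here is a claim about the Yang–Mills mass gap

CITATION HEADER (v1.0.1: quotations made verbatim from the text layer).  [III] p. 263: *"Theorem 2. Under the assumptions of Theorem 1 there exists a constant E₁ independent
of j, k, Ω, {Ω_j}, {Λ_j}, T (but dependent on the other constants occurring in the formulation of this theorem), such that"* (2.43) *"for β < 1, and sufficiently regular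
configurations U_k = U_k(V)"*; p. 264: *"These bounds yield the following bounds for the effective actions"* (2.49), and *"Corollary 3 (Ultraviolet Stability). Under the assumptions
of Theorem 1 there exist constants E₋, E₊ independent of η and T, but depending on g_k, such that"* (2.50).  [B16] p. 387 ll. 21–27: *"… hence also an improved bound (1.89), with
the additional term −κ₁d_k(X) in the exponential. This implies the inequality (2.50) [III], hence Corollary 3."*

WHY THIS FILE.  g2's p601758 §3 is the N11 → N13 edge END at the record with the printed budget, [III] Theorem 2 displayed there as two forty-line V-indexed families `h243` ∕
`h244`.  dag-n11-w2 g2 KEYED those sentences (p605075, «FOR YOUR SOCKET»): ONE carrier `sect2DataOfRecord₁₃Keyed θ P 𝒯 𝒰` (level, history, background class) on which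
`Ineq243 ∧ Ineq244` — equivalently (`ineq243_keyed_iff` ∕ `ineq244_keyed_iff`) the per-datum families — is ONE token; along dag-n11-e's chain the term values ARE the chain's own
witness and the (2.48) 𝐁-side is DISCHARGED from `(hσ, hT)` + the (2.41)(ii)-regular class.  THIS FILE plugs those tokens into p601758, reading the V-indexed data THROUGH the
carrier — `t V := 𝒯 k (s V)`, `U_k(V) ∈ 𝒰 k (s V)` (`hU`), `Γ_n ≥ |Γ_n(s V)|` (`hΓvol`) — so the END's Theorem-2 input is ONE named sentence (§1), resp. `B14.Thm2Printed` keyed (§2).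

WHAT THIS FILE PROVES (theorems only, 0 `def`, 0 `sorry`; BY NAME over p601758 ∕ p605075 ∕ p589816 ∕ p591353 — nothing re-proved).
§0 `cA_nonneg` (sign of Theorem 2's constant from `E₁ ≥ 0`, `1 < L`, `0 < β`, `0 ≤ 1 + 2B₁ + E₂`) · ★ `ineq249up_at_record₁₃CoPH_of_ineq243_ineq244_keyed_of_aPrimeEq` (dag-n13-w3's §4
   `ineq249up_…_of_thm2_of_aPrimeEq` with `h243 ∕ h244` := the keyed tokens at the datum `(k, s, U_k(V))`) · ★ `ineq249low_at_record₁₃CoPH_of_ineq243_ineq244_keyed_of_phi_eq_one_of_aPrimeEq`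
   (part 2's lower half on the all-small history, same replacement).
§1 ★★ `uvIneq_at_record₁₃CoPH_of_ineq243_ineq244_keyed_of_fullBudget` — p601758 §3 with `h243 ∕ h244` := `Ineq243 ∧ Ineq244` on the keyed carrier; new named rows `hk : k ≤ K`,
   `hg : g_j ≥ 0`, `hU`, `hΓvol`; `h248`, `hφ ∕ hφ1`, `hA'eq`, the budget data, the (1.90) gas, `hH` VERBATIM.
§2 ★★★ `uvIneq_at_record₁₃CoPH_of_thm2Printed_chainWitness_of_obligations_of_fullBudget` — THE CHAIN EDITION: term values := dag-n11-e's chain witness, `B14.Thm2Printed` keyed to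
   the chain (`∃ E₁ R₁ ≥ 0`), (2.48) DISCHARGED by `(hσ, hT)` + def-T's provisos (the datum's own `h`) + live selector + admissibility + signs + the (2.41)(ii)-regular class `h𝒰`
   (`h248_chainWitness_of_chainFormAt` ∘ `chainFormAt_all_of_obligations`), `B₁ := θ.s2.lf.B₀·K₀(4·2^d,2d)`; conclusion: (2.46)'s `R₁`-smallness ⟹ (0.1) at every `V`.

HONEST SCOPE ∕ A6.  By-name junction, count-neutral, LOCATED exactly as p601758: the (1.72) representation `R` of `densOfRecord₁₃` (`hH`) has NO supplier in the tree (n10-w1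
evidence #17, LOCATED GAP #1 — definer-grade object); the seams `hA'eq` («`R.A′ V` IS print's (2.23) action of record at `U_k(V)` along `s V` with the carrier's ∕ chain's term values»),
`hφ1` («on the support the history is all-small»), `hU` («`U_k(V)` lies in the keyed class at `s V`») are WHAT `R` and the carrier ARE — displayed, not decided.  Nothing of Bałaban's
is asserted: [III] Theorem 2 (keyed: `Ineq243 ∧ Ineq244`, resp. `B14.Thm2Printed`), the supply chain's obligations `(hσ, hT)`, Corollary 3, [B16] Theorem 1, the (1.79)-factor forms,
(1.80) ∕ (1.80)⁺, the (1.90) gas bounds stay displayed hypotheses; N11 ∕ N13 NOT discharged; K0⁷ ∕ K1⁷ NOT closed (`stub_nodes13PWS` ∕ `stub_runRows13PWS` NOT proved); counts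
UNMOVED (discharged 5∕27 · Track A 5∕28); one finite `𝕋⁴_{L^K}` programme at fixed `ε = L^{−K}`, Bałaban AS PRINTED; R4 closes the conditional finite-𝕋⁴ rung `BalabanLadder.UV`
only — the Yang–Mills mass gap (Clay) is NOT proved by any of this; nothing continuum ∕ ℝ⁴ ∕ OS.  No `def`, no `sorry`, no `instance`, no `notation`. -/

noncomputable section

open MeasureTheory
open scoped BigOperators Matrix.Norms.L2Operator

namespace Summit.QuantumFields.YangMills.BalabanUVNodes.N13Cor3AsymJunctionThm2KeyedFullBudgetAtRecord13CoPH

open Literature.MathematicalPhysics.QuantumFieldTheory.Balaban1983to89 Step B14.Eq225Concrete B14.LocalCoupling B14Thm2 Finset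
open T4Continuum T4DatumAssembly Node00 DagBinding FlowStepRuns B15DeterminingSets
open B10Eq38TorusDomains (toFine)
open B16Cor3Ops (PosOp Repr172)
open TreeLengthTorus (tsys proj TPt TAdj)
open B13FamilySum (Ineq126 VolBound)
open B16Eq190Resummation (bracket mayerTerm F191 polys190 LocalOps DepOn)
open B13ScaleTransfer (Pt FaceConnected)
open TreeLength (treeLen)
open B16SProfile (Sop)
open B13Factor210Literal (fineCubes)
open Summit.QuantumFields.YangMills.Theorems.BalabanUVNodesN11Sect3SupplyChainDefs (Sect3Supplier chainWitness)
open Summit.QuantumFields.YangMills.Theorems.BalabanUVNodesN11Sect3SupplyChainObligationsDefs (SupplierObligations NoExpansionObligation ChainFormAt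
  chainFormAt_all_of_obligations)
open Summit.QuantumFields.YangMills.Theorems.BalabanUVNodesN11Thm2Sect2DataOfRecordKeyedDefs (sect2DataOfRecord₁₃Keyed)
open Summit.QuantumFields.YangMills.Theorems.BalabanUVNodesN11Thm2OfRecordKeyed (exists_nonneg_constants_of_thm2Printed_keyed)
open Summit.QuantumFields.YangMills.Theorems.BalabanUVNodesN11Thm2AlongSupplyChain (h248_chainWitness_of_chainFormAt)
open Summit.QuantumFields.YangMills.Theorems.BalabanUVNodesN11Thm2AlongSupplyChainUpperHalf (action23_le_of_ineq243_ineq244_keyed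
  ineq249_constCoupling_of_ineq243_ineq244_keyed_of_phi_eq_one)
open Summit.QuantumFields.YangMills.BalabanUVNodes.N13Cor3AsymJunctionAtRecord13CoPH (wilsonAction4_Uk_eq_wilsonBGOfRecord ineq249low_of_ineq249)
open Summit.QuantumFields.YangMills.BalabanUVNodes.N13Cor3AsymJunctionFullBudgetAtRecord13CoPH (uvIneq_at_record₁₃CoPH_of_gas_asym_of_fullBudget)

/-! ## §0. The two (2.49) halves at a configuration FROM THE KEYED TOKENS (dag-n13-w3's §4 ∕ part 2 with `h243 ∕ h244` := `Ineq243 ∧ Ineq244` keyed) -/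

/-- **Sign of Theorem 2's constant** `C_A = E₁(1−L^{−β})⁻¹ + 1 + 2B₁ + E₂`: nonnegative once `E₁ ≥ 0`, `1 < L`, `0 < β` and `0 ≤ 1 + 2B₁ + E₂` (the latter displayed; in print
`B₁, E₂ ≥ 0`). [cite: Balaban1988Convergent, (2.49) p.264 (bookkeeping)] -/
theorem cA_nonneg {E₁ L β B₁ E₂ : ℝ} (hE : 0 ≤ E₁) (hL : 1 < L) (hβ : 0 < β) (hrest : 0 ≤ 1 + 2 * B₁ + E₂) :
    0 ≤ E₁ * (1 - L ^ (-β))⁻¹ + 1 + 2 * B₁ + E₂ := by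
  have hlt : L ^ (-β) < 1 := Real.rpow_lt_one_of_one_lt_of_neg hL (neg_neg_of_pos hβ)
  have hinv : 0 ≤ (1 - L ^ (-β))⁻¹ := inv_nonneg.mpr (by linarith)
  nlinarith [mul_nonneg hE hinv]

section Halves

variable (F : T4Family) (N : ℕ) [NeZero N]
variable (θ : Stage13HParams F N) (P : B12.RunParams) (k : ℕ)
variable (𝒯 : (k : ℕ) → SeqOfRecord F θ.ν θ.τ9.M (gOfRecord₁₃ F N θ.toStage13Params P) P.K k → Sect2.TermValues (F.P P.K) (MatA N) (FluctV N) θ.τ9.M)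
variable (𝒰 : (k : ℕ) → SeqOfRecord F θ.ν θ.τ9.M (gOfRecord₁₃ F N θ.toStage13Params P) P.K k → Set (GaugeField (F.P P.K) 0 (SU N)))

open Classical in
/-- **★ THE UPPER (2.49) HALF AT `V` IN THE COR.-3 CHAIN's CURRENCY FROM THE KEYED TOKENS** — dag-n13-w3's `ineq249up_at_record₁₃CoPH_of_thm2_of_aPrimeEq` with its displayed
sentence families `h243 ∕ h244` REPLACED by `Ineq243 ∧ Ineq244` on dag-n11-w2's keyed carrier `sect2DataOfRecord₁₃Keyed θ P 𝒯 𝒰`, READ at the datum `(k ≤ K, s, U_k(V) ∈ 𝒰 k s)`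
with term values `𝒯 k s` (p605075 §1 `action23_le_of_ineq243_ineq244_keyed`, Wilson term by `rfl`); displayed as there: `g_j ≥ 0`, `β_j ≥ 0`, `φ_j ≤ 1`, volumes `Γ_n ≥ |Γ_n(s)|`,
(2.46)'s inputs, (2.48) `h248`, the vacuum sentence, and the seam `hA'eq`. [cite: Balaban1988Convergent, Thm 2 p.263, (2.49)–(2.50) p.264, (2.24) p.259; Balaban1989LargeFieldII, (1.72) p.379] -/
theorem ineq249up_at_record₁₃CoPH_of_ineq243_ineq244_keyed_of_aPrimeEq {Dom : Type*} (R : Repr172 (GaugeField (F.P P.K) k (SU N)) Dom)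
    {L β E₁ R₁ : ℝ} {κ₀ : ℕ}
    (h243K : Ineq243 (sect2DataOfRecord₁₃Keyed θ P 𝒯 𝒰) L β E₁) (h244K : Ineq244 (sect2DataOfRecord₁₃Keyed θ P 𝒯 𝒰) R₁ κ₀)
    (hL : 1 < L) (hβ : 0 < β) (hE : 0 ≤ E₁) (hR : 0 ≤ R₁) (hκ : 7 ≤ κ₀) (hk : k ≤ P.K)
    (hg : ∀ j, j ≤ P.K → 0 ≤ gOfRecord₁₃ F N θ.toStage13Params P j)
    (V : GaugeField (F.P P.K) k (SU N)) (s : SeqOfRecord F θ.ν θ.τ9.M (gOfRecord₁₃ F N θ.toStage13Params P) P.K k)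
    (hU : Uk F N P.K k θ.εbg V ∈ 𝒰 k s)
    (hβj : ∀ j, 1 ≤ j → j ≤ k → 0 ≤ 1 / gOfRecord₁₃ F N θ.toStage13Params P (j - 1) ^ 2 - 1 / gOfRecord₁₃ F N θ.toStage13Params P j ^ 2)
    (hφ : ∀ j, 1 ≤ j → j ≤ k → ∀ x, θ.Phih P k s.Ω s.Λ j x ≤ 1)
    (a : Tk.SFluct (F.P P.K) (FluctV N)) (Ek EkLog EkRest : ℝ) (hEk : Ek = EkLog + EkRest) (B₁ E₂ : ℝ) (Γ : ℕ → ℝ)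
    (hΓvol : ∀ n, 1 ≤ n → n ≤ k → ((univ.filter fun y : Site (F.P P.K) n => toFine n y ∈ gammaRegion s.Ω k n).card : ℝ) ≤ Γ n)
    (hsum : ∀ n, 1 ≤ n → n ≤ k → ∑ j ∈ Icc 1 n, (gOfRecord₁₃ F N θ.toStage13Params P j) ^ κ₀ ≤ (gOfRecord₁₃ F N θ.toStage13Params P n) ^ (κ₀ - 6))
    (hsmall : ∀ n, 1 ≤ n → n ≤ k → R₁ * (gOfRecord₁₃ F N θ.toStage13Params P n) ^ (κ₀ - 6) ≤ 1)
    (h248 : |B240 (sect2TowerOfRecord F N (FluctV N) P.K (settingOfRecord₁₃ F N θ.toStage13Params P) (θ.rzAt P s) s (𝒯 k s))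
        (fun j X => Sect2.admB (F.P P.K) θ.ν θ.τ9.M (gOfRecord₁₃ F N θ.toStage13Params P) s.Ω s.Λ j (Sect2.domSites (F.P P.K) θ.τ9.M j X)) a k
        (Uk F N P.K k θ.εbg V)| ≤ 2 * B₁ * ∑ n ∈ Icc 1 k, Γ n)
    (hvac : VacuumRestBound EkRest E₂ Γ k)
    (hA'eq : R.A' V =
      (sect2ActionDataOfRecord F N (FluctV N) P.K (settingOfRecord₁₃ F N θ.toStage13Params P) (θ.rzAt P s) s (𝒯 k s) a Ek).action23 k (Uk F N P.K k θ.εbg V)) :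
    R.A' V + 1 / (gOfRecord₁₃ F N θ.toStage13Params P k) ^ 2 * wilsonBGOfRecord F N θ.εbg P k V - (-EkLog) ≤
      (E₁ * (1 - L ^ (-β))⁻¹ + 1 + 2 * B₁ + E₂) * ∑ n ∈ Icc 1 k, Γ n := by
  have hle := action23_le_of_ineq243_ineq244_keyed θ P 𝒯 𝒰 h243K h244K hL hβ hE hR hκ hk s (Uk F N P.K k θ.εbg V) hU hg hβj hφ
    a Ek EkLog EkRest hEk B₁ E₂ Γ hΓvol hsum hsmall h248 hvac
  rw [hA'eq, ← wilsonAction4_Uk_eq_wilsonBGOfRecord F N P k θ.εbg V]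
  linarith

open Classical in
/-- **★ THE LOWER (2.49) HALF AT `V` ON THE ALL-SMALL HISTORY FROM THE KEYED TOKENS** — part 2's `ineq249low_at_record₁₃CoPH_of_thm2_of_phi_eq_one_of_aPrimeEq` with
`h243 ∕ h244` := `Ineq243 ∧ Ineq244` keyed, READ at `(k, s, U_k(V))` (p605075 §3 `ineq249_constCoupling_of_ineq243_ineq244_keyed_of_phi_eq_one`: where every cut-off `φ_j ≡ 1` the
smeared and constant currencies coincide, p. 259); `hφ1`, volumes, (2.46)'s inputs, (2.48), vacuum and the seam `hA'eq` displayed — the inequality §1's `h249low` binder asks on the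
support. [cite: Balaban1988Convergent, Thm 2 p.263, (2.49)–(2.50) p.264, p.259; Balaban1989LargeFieldII, (1.72) p.379, p.391 (bookkeeping)] -/
theorem ineq249low_at_record₁₃CoPH_of_ineq243_ineq244_keyed_of_phi_eq_one_of_aPrimeEq {Dom : Type*} (R : Repr172 (GaugeField (F.P P.K) k (SU N)) Dom)
    {L β E₁ R₁ : ℝ} {κ₀ : ℕ}
    (h243K : Ineq243 (sect2DataOfRecord₁₃Keyed θ P 𝒯 𝒰) L β E₁) (h244K : Ineq244 (sect2DataOfRecord₁₃Keyed θ P 𝒯 𝒰) R₁ κ₀)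
    (hL : 1 < L) (hβ : 0 < β) (hE : 0 ≤ E₁) (hR : 0 ≤ R₁) (hκ : 7 ≤ κ₀) (hk : k ≤ P.K)
    (hg : ∀ j, j ≤ P.K → 0 ≤ gOfRecord₁₃ F N θ.toStage13Params P j)
    (V : GaugeField (F.P P.K) k (SU N)) (s : SeqOfRecord F θ.ν θ.τ9.M (gOfRecord₁₃ F N θ.toStage13Params P) P.K k)
    (hU : Uk F N P.K k θ.εbg V ∈ 𝒰 k s)
    (hφ1 : ∀ j, 1 ≤ j → j ≤ k → ∀ x, θ.Phih P k s.Ω s.Λ j x = 1)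
    (a : Tk.SFluct (F.P P.K) (FluctV N)) (Ek EkLog EkRest : ℝ) (hEk : Ek = EkLog + EkRest) (B₁ E₂ : ℝ) (Γ : ℕ → ℝ)
    (hΓvol : ∀ n, 1 ≤ n → n ≤ k → ((univ.filter fun y : Site (F.P P.K) n => toFine n y ∈ gammaRegion s.Ω k n).card : ℝ) ≤ Γ n)
    (hsum : ∀ n, 1 ≤ n → n ≤ k → ∑ j ∈ Icc 1 n, (gOfRecord₁₃ F N θ.toStage13Params P j) ^ κ₀ ≤ (gOfRecord₁₃ F N θ.toStage13Params P n) ^ (κ₀ - 6))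
    (hsmall : ∀ n, 1 ≤ n → n ≤ k → R₁ * (gOfRecord₁₃ F N θ.toStage13Params P n) ^ (κ₀ - 6) ≤ 1)
    (h248 : |B240 (sect2TowerOfRecord F N (FluctV N) P.K (settingOfRecord₁₃ F N θ.toStage13Params P) (θ.rzAt P s) s (𝒯 k s))
        (fun j X => Sect2.admB (F.P P.K) θ.ν θ.τ9.M (gOfRecord₁₃ F N θ.toStage13Params P) s.Ω s.Λ j (Sect2.domSites (F.P P.K) θ.τ9.M j X)) a k
        (Uk F N P.K k θ.εbg V)| ≤ 2 * B₁ * ∑ n ∈ Icc 1 k, Γ n)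
    (hvac : VacuumRestBound EkRest E₂ Γ k)
    (hA'eq : R.A' V =
      (sect2ActionDataOfRecord F N (FluctV N) P.K (settingOfRecord₁₃ F N θ.toStage13Params P) (θ.rzAt P s) s (𝒯 k s) a Ek).action23 k (Uk F N P.K k θ.εbg V)) :
    -((E₁ * (1 - L ^ (-β))⁻¹ + 1 + 2 * B₁ + E₂) * ∑ n ∈ Icc 1 k, Γ n) ≤
      R.A' V + 1 / (gOfRecord₁₃ F N θ.toStage13Params P k) ^ 2 * wilsonBGOfRecord F N θ.εbg P k V - (-EkLog) := by
  have h249 := ineq249_constCoupling_of_ineq243_ineq244_keyed_of_phi_eq_one θ P 𝒯 𝒰 h243K h244K hL hβ hE hR hκ hk s (Uk F N P.K k θ.εbg V) hU hg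
    hφ1 a Ek EkLog EkRest hEk B₁ E₂ Γ hΓvol hsum hsmall h248 hvac
  rw [hA'eq, ← wilsonAction4_Uk_eq_wilsonBGOfRecord F N P k θ.εbg V]
  exact ineq249low_of_ineq249 h249

end Halves

/-! ## §1. THE END WITH THE PRINTED BUDGET AND `Ineq243 ∧ Ineq244` ON THE KEYED CARRIER (p601758 §3 with `h243 ∕ h244` := ONE keyed token each) -/

section KeyedEnd

variable (F : T4Family) (N : ℕ) [NeZero N]
variable (θ : Stage13HParams F N) (h : θ.Provisos₁₃CoPH F N) (P : B12.RunParams) (k : ℕ)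
variable (𝒯 : (k : ℕ) → SeqOfRecord F θ.ν θ.τ9.M (gOfRecord₁₃ F N θ.toStage13Params P) P.K k → Sect2.TermValues (F.P P.K) (MatA N) (FluctV N) θ.τ9.M)
variable (𝒰 : (k : ℕ) → SeqOfRecord F θ.ν θ.τ9.M (gOfRecord₁₃ F N θ.toStage13Params P) P.K k → Set (GaugeField (F.P P.K) 0 (SU N)))

open Classical in
/-- **★★ (UV₁₃) AT LEVEL `k ≤ K` OF THE RUN `P` AT NODE 00's STAGE-13 RECORD FROM `Ineq243 ∧ Ineq244` ON THE KEYED CARRIER + THE PRINTED BUDGET** — g2's §3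
`uvIneq_at_record₁₃CoPH_of_thm2_of_fullBudget` with its V-indexed Theorem-2 sentence families `h243` ∕ `h244` REPLACED by the two keyed tokens `h243K` ∕ `h244K` on dag-n11-w2's
carrier `sect2DataOfRecord₁₃Keyed θ P 𝒯 𝒰` and the configuration-indexed data READ THROUGH THE CARRIER: history `s V`, term values `𝒯 k (s V)`, fluctuation argument `a V`,
membership `hU : U_k(V) ∈ 𝒰 k (s V)`, volumes `hΓvol : Γ_n ≥ |Γ_n(s V)|`; new named rows `hk : k ≤ K`, `hg : g_j ≥ 0`; EVERY OTHER BINDER VERBATIM from §3 there ((2.48) `h248`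
and the seam `hA'eq` with the carrier's term values, `hφ`, `hφ1` ON THE SUPPORT, `hβj`, (2.46)'s `hsum` ∕ `hsmall6`, `hvac`, `hlog` ∕ `hlog'`, `hΓ`, `hCA`, the budget data, the
(1.90) gas, the (1.72) datum `hH`).  Conclusion: `B16.UVIneq ((datumOfRecord₁₃CoPH F N θ h).C P) k V E₋ E₊` at every `V` with
`E₋ = C_A·c_Γ + c_L + πc·c₁e^{τc_v}K₀`, `E₊ = C_A·c_Γ + c_L′ + πc·c₁e^{τc_v}K₀ + M₁⁻⁴·K₀(64,8)·Σ_{i<2} e^{−c₀}`, `C_A = E₁(1−L^{−β})⁻¹ + 1 + 2B₁ + E₂`.  CONDITIONAL on every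
input — LOCATED (`hH` has no supplier; `hA'eq` ∕ `hφ1` ∕ `hU` are what `R` and the carrier are); [III] Theorem 2 ∕ Cor. 3 NOT proved; nothing of Bałaban's asserted; count-neutral.
[cite: Balaban1988Convergent, Thm 2 (2.43)–(2.44) p.263, (2.45)–(2.50) pp.263–264, (2.24) p.259; Balaban1989LargeFieldII, (0.1) p.356, (1.72) p.379, (1.80) p.384, p.387 ll.21–27, p.391] -/
theorem uvIneq_at_record₁₃CoPH_of_ineq243_ineq244_keyed_of_fullBudget (Nc : ℕ) [NeZero Nc] (R : Repr172 (GaugeField (F.P P.K) k (SU N)) (tsys 4 Nc).Dom)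
    {M₁ : ℝ} (hM : M₁ ≠ 0) (hnum : (Fintype.card (Site (F.P P.K) k) : ℝ) = (M₁ * Nc) ^ 4)
    {κ₁ : ℝ} (hκ : B12TreeDecay.kappa₀ (4 * 2 ^ 4) (2 * 4) ≤ κ₁) (hκ₁ : 0 ≤ κ₁) (c₀ : ℝ)
    (hH : R.Holds (densOfRecord₁₃ F N θ.toStage13Params P k))
    (hχ01 : ∀ a V, 0 ≤ R.χ a V ∧ R.χ a V ≤ 1)
    (h0χ : ∀ V, R.χ R.allSmall V = chiβOfRecord₁₃ F N θ.toStage13Params P.K (gOfRecord₁₃ F N θ.toStage13Params P) k V)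
    -- the components of `Z_k`: composite structure and per-component (1.79)/(1.80) data
    (T : R.Adm → (tsys 4 Nc).Dom → PosOp (GaugeField (F.P P.K) k (SU N))) (l : R.Adm → List (tsys 4 Nc).Dom)
    (hnd : ∀ a, (l a).Nodup) (hset : ∀ a, (l a).toFinset = R.Zc a)
    (hTZ : ∀ a Fn V, (R.TZ a).T Fn V = (PosOp.pi (T a) (l a)).T Fn V)
    (b : Step.Budget.Consts) (Lb : ℝ) {Rk q : ℕ} (hRk : 0 < Rk) (hq : 0 < q)
    (hC : 0 ≤ b.C) (hbM : 0 ≤ b.M) (hRm : ∀ m, 0 ≤ b.R m) (hdim : b.d = 4) (hRq : ((Rk * q : ℕ) : ℝ) = Lb * b.R (k + 1)) (hLb : 0 ≤ Lb)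
    (hslope2 : 2 * (κ₁ * (4 * 2 ^ 4) * Lb ^ b.d) ≤ b.C * b.M ^ b.d * b.R (k + 1))
    (X₀ : R.Adm → (tsys 4 Nc).Dom → Finset (Pt 4)) (K : R.Adm → (tsys 4 Nc).Dom → ℕ)
    (κ Pp : R.Adm → (tsys 4 Nc).Dom → ℝ) (s : R.Adm → (tsys 4 Nc).Dom → ℕ → ℝ)
    (hdataZ : ∀ a, ∀ X ∈ R.Zc a, (X₀ a X).Nonempty ∧ FaceConnected (X₀ a X) ∧
      X.1 = (fineCubes Rk (X₀ a X)).image (proj Nc) ∧ 1 ≤ K a X ∧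
      (∀ V, (T a X).T 1 V ≤ Real.exp (-(κ a X) - Pp a X)) ∧ Step.Budget.Controls b k (K a X) (κ a X) (s a X) ∧
      (∀ m, 0 ≤ s a X m) ∧ s a X (k + 1) = treeLen (Sop q (X₀ a X)) ∧ c₀ ≤ Pp a X)
    -- the domains `Y_i`: composite structure and per-domain (1.80)⁺ horizon-0 data
    (TY : R.Adm → (tsys 4 Nc).Dom → PosOp (GaugeField (F.P P.K) k (SU N))) (lY : R.Adm → List (tsys 4 Nc).Dom)
    (hndY : ∀ a, (lY a).Nodup) (hsetY : ∀ a, (lY a).toFinset = R.Ys a)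
    (hTYs : ∀ a Fn V, (R.TYs a).T Fn V = (PosOp.pi (TY a) (lY a)).T Fn V)
    (SY : R.Adm → (tsys 4 Nc).Dom → Finset (Pt 4)) (κY PY : R.Adm → (tsys 4 Nc).Dom → ℝ) (sY : R.Adm → (tsys 4 Nc).Dom → ℕ → ℝ)
    (hdataY : ∀ a, ∀ Y ∈ R.Ys a, (SY a Y).Nonempty ∧ FaceConnected (SY a Y) ∧
      Y.1 = (fineCubes Rk (SY a Y)).image (proj Nc) ∧ (∀ V, (TY a Y).T 1 V ≤ Real.exp (-(κY a Y) - PY a Y)) ∧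
      Step.Budget.Controls b k 0 (κY a Y - κ₁ * treeLen (fineCubes Rk (SY a Y))) (sY a Y) ∧ c₀ ≤ PY a Y)
    -- the (1.90) gas of every admissible term (verbatim)
    {LF DomY Cube Var Sv : Type*} [Fintype LF] [Fintype DomY] [Fintype Cube] [DecidableEq LF] [DecidableEq DomY]
    [DecidableEq Cube] {adjC : Cube → Cube → Prop} [DecidableRel adjC]
    (hrefl : ∀ a, adjC a a) (hsymm : ∀ a b, adjC a b → adjC b a)
    {locX : LF → Finset Cube} {locY : DomY → Finset Cube} {site : Var → Cube} (Yfix : R.Adm → Finset Cube)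
    (houtX : ∀ a j, (locX j \ Yfix a).Nonempty) (houtY : ∀ a Y, (locY Y \ Yfix a).Nonempty)
    (Op : R.Adm → Finset LF → ((Var → Sv) → ℂ) →+ ((Var → Sv) → ℂ))
    (hOps : ∀ a, LocalOps adjC locX (Yfix a) site (Op a))
    (hOpReal : ∀ a (S : Finset LF) (f : (Var → Sv) → ℂ), (∀ ψ, (f ψ).im = 0) → ∀ φ, (Op a S f φ).im = 0)
    (Vt : R.Adm → DomY → (Var → Sv) → ℂ) (hV : ∀ a Y, DepOn (Yfix a) site (Vt a Y) (locY Y))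
    (hVreal : ∀ a Y ψ, (Vt a Y ψ).im = 0) (cfg : GaugeField (F.P P.K) k (SU N) → (Var → Sv))
    {nbr : Cube → Finset Cube} (hnbr : ∀ a b, adjC a b → a ∈ nbr b) {νn : ℝ} (hν : ∀ b, ((nbr b).card : ℝ) ≤ νn)
    {d : R.Adm → Finset Cube → ℝ} {c₁ Rr κc K₀ cv τ : ℝ} (hd : ∀ a X, 0 ≤ d a X) (hc₁ : 0 ≤ c₁) (hK₀ : 0 ≤ K₀) (hτ : 0 ≤ τ)
    (h197 : ∀ a V X, ‖F191 adjC locX locY (Yfix a) (mayerTerm (Op a) (Vt a) (cfg V)) X‖ ≤ c₁ * Real.exp (-(Rr * d a X)))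
    (h126 : ∀ a, Ineq126 (polys190 adjC locX locY (Yfix a)) (fun X => X \ Yfix a) (d a) κc K₀)
    (hvol : ∀ a, VolBound (polys190 adjC locX locY (Yfix a)) (fun X => X \ Yfix a) (d a) cv)
    (hrate : κc + τ * cv ≤ Rr) (hsmall : c₁ * Real.exp (τ * cv) * K₀ * νn ≤ τ)
    (hjunction : ∀ a V, R.curly a V = (bracket (Op a) (Vt a) (cfg V)).re)
    {πc : ℝ} (hQ : (Fintype.card Cube : ℝ) ≤ πc * (Fintype.card (Site (F.P P.K) k) : ℝ))
    -- [III] Theorem 2 KEYED: the two tokens on dag-n11-w2's carrier `(𝒯, 𝒰)`, the level in range, couplings `≥ 0`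
    {L β E₁ R₁ : ℝ} {κ₀ : ℕ}
    (h243K : Ineq243 (sect2DataOfRecord₁₃Keyed θ P 𝒯 𝒰) L β E₁) (h244K : Ineq244 (sect2DataOfRecord₁₃Keyed θ P 𝒯 𝒰) R₁ κ₀)
    (hL : 1 < L) (hβ : 0 < β) (hE : 0 ≤ E₁) (hR₁ : 0 ≤ R₁) (hκ₀ : 7 ≤ κ₀) (hk : k ≤ P.K)
    (hg : ∀ j, j ≤ P.K → 0 ≤ gOfRecord₁₃ F N θ.toStage13Params P j)
    -- the configuration-indexed data READ THROUGH THE CARRIER: history, membership of `U_k(V)`, fluctuation argument, volumes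
    (sV : (V : GaugeField (F.P P.K) k (SU N)) → SeqOfRecord F θ.ν θ.τ9.M (gOfRecord₁₃ F N θ.toStage13Params P) P.K k)
    (hU : ∀ V, Uk F N P.K k θ.εbg V ∈ 𝒰 k (sV V))
    (aV : GaugeField (F.P P.K) k (SU N) → Tk.SFluct (F.P P.K) (FluctV N))
    (Ek EkLog EkRest : ℝ) (hEk : Ek = EkLog + EkRest) (B₁ E₂ : ℝ) (Γ : ℕ → ℝ)
    (hΓvol : ∀ V, ∀ n, 1 ≤ n → n ≤ k → ((univ.filter fun y : Site (F.P P.K) n => toFine n y ∈ gammaRegion (sV V).Ω k n).card : ℝ) ≤ Γ n)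
    (hβj : ∀ j, 1 ≤ j → j ≤ k → 0 ≤ 1 / gOfRecord₁₃ F N θ.toStage13Params P (j - 1) ^ 2 - 1 / gOfRecord₁₃ F N θ.toStage13Params P j ^ 2)
    (hφ : ∀ V, ∀ j, 1 ≤ j → j ≤ k → ∀ x, θ.Phih P k (sV V).Ω (sV V).Λ j x ≤ 1)
    (hφ1 : ∀ V, chiβOfRecord₁₃ F N θ.toStage13Params P.K (gOfRecord₁₃ F N θ.toStage13Params P) k V ≠ 0 →
      ∀ j, 1 ≤ j → j ≤ k → ∀ x, θ.Phih P k (sV V).Ω (sV V).Λ j x = 1)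
    (hsum : ∀ n, 1 ≤ n → n ≤ k → ∑ j ∈ Icc 1 n, (gOfRecord₁₃ F N θ.toStage13Params P j) ^ κ₀ ≤ (gOfRecord₁₃ F N θ.toStage13Params P n) ^ (κ₀ - 6))
    (hsmall6 : ∀ n, 1 ≤ n → n ≤ k → R₁ * (gOfRecord₁₃ F N θ.toStage13Params P n) ^ (κ₀ - 6) ≤ 1)
    (h248 : ∀ V, |B240 (sect2TowerOfRecord F N (FluctV N) P.K (settingOfRecord₁₃ F N θ.toStage13Params P) (θ.rzAt P (sV V)) (sV V) (𝒯 k (sV V)))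
        (fun j X => Sect2.admB (F.P P.K) θ.ν θ.τ9.M (gOfRecord₁₃ F N θ.toStage13Params P) (sV V).Ω (sV V).Λ j (Sect2.domSites (F.P P.K) θ.τ9.M j X)) (aV V) k
        (Uk F N P.K k θ.εbg V)| ≤ 2 * B₁ * ∑ n ∈ Icc 1 k, Γ n)
    (hvac : VacuumRestBound EkRest E₂ Γ k)
    (hA'eq : ∀ V, R.A' V =
      (sect2ActionDataOfRecord F N (FluctV N) P.K (settingOfRecord₁₃ F N θ.toStage13Params P) (θ.rzAt P (sV V)) (sV V) (𝒯 k (sV V)) (aV V) Ek).action23 k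
        (Uk F N P.K k θ.εbg V))
    -- the sizes of the logarithmic vacuum term, the volume majorant, the sign of Theorem 2's constant
    {cΓ cL cL' : ℝ} (hCA : 0 ≤ E₁ * (1 - L ^ (-β))⁻¹ + 1 + 2 * B₁ + E₂)
    (hΓ : ∑ n ∈ Icc 1 k, Γ n ≤ cΓ * (Fintype.card (Site (F.P P.K) k) : ℝ))
    (hlog : -(cL * (Fintype.card (Site (F.P P.K) k) : ℝ)) ≤ -EkLog)
    (hlog' : -EkLog ≤ cL' * (Fintype.card (Site (F.P P.K) k) : ℝ)) :
    ∀ V : GaugeField (F.P P.K) k (SU N),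
      B16.UVIneq ((datumOfRecord₁₃CoPH F N θ h).C P) k V
        ((E₁ * (1 - L ^ (-β))⁻¹ + 1 + 2 * B₁ + E₂) * cΓ + cL + πc * (c₁ * Real.exp (τ * cv) * K₀))
        ((E₁ * (1 - L ^ (-β))⁻¹ + 1 + 2 * B₁ + E₂) * cΓ + cL' + πc * (c₁ * Real.exp (τ * cv) * K₀) +
          M₁⁻¹ ^ 4 * B12TreeDecay.K₀ (4 * 2 ^ 4) (2 * 4) * ∑ _i : Fin 2, Real.exp (-c₀)) :=
  uvIneq_at_record₁₃CoPH_of_gas_asym_of_fullBudget F N θ h P k Nc R hM hnum hκ hκ₁ c₀ hH hχ01 h0χ T l hnd hset hTZ b Lb hRk hq hC hbM hRm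
    hdim hRq hLb hslope2 X₀ K κ Pp s hdataZ TY lY hndY hsetY hTYs SY κY PY sY hdataY hrefl hsymm Yfix houtX houtY Op hOps hOpReal Vt hV
    hVreal cfg hnbr hν hd hc₁ hK₀ hτ h197 h126 hvol hrate hsmall hjunction hQ (fun _ => -EkLog) hCA hΓ
    (fun V => ineq249up_at_record₁₃CoPH_of_ineq243_ineq244_keyed_of_aPrimeEq F N θ P k 𝒯 𝒰 R h243K h244K hL hβ hE hR₁ hκ₀ hk hg V (sV V) (hU V)
      hβj (hφ V) (aV V) Ek EkLog EkRest hEk B₁ E₂ Γ (hΓvol V) hsum hsmall6 (h248 V) hvac (hA'eq V))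
    (fun V hV => ineq249low_at_record₁₃CoPH_of_ineq243_ineq244_keyed_of_phi_eq_one_of_aPrimeEq F N θ P k 𝒯 𝒰 R h243K h244K hL hβ hE hR₁ hκ₀ hk hg
      V (sV V) (hU V) (hφ1 V hV) (aV V) Ek EkLog EkRest hEk B₁ E₂ Γ (hΓvol V) hsum hsmall6 (h248 V) hvac (hA'eq V))
    (fun _ _ => hlog) (fun _ => hlog')

end KeyedEnd

/-! ## §2. THE CHAIN EDITION: term values := dag-n11-e's chain witness, `B14.Thm2Printed` keyed to the chain, (2.48) DISCHARGED by the supply chain's obligations -/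

section ChainEnd

variable (F : T4Family) (N : ℕ) [NeZero N]
variable (θ : Stage13HParams F N) (h : θ.Provisos₁₃CoPH F N) (P : B12.RunParams) (k : ℕ)
variable (𝒰 : (k : ℕ) → SeqOfRecord F θ.ν θ.τ9.M (gOfRecord₁₃ F N θ.toStage13Params P) P.K k → Set (GaugeField (F.P P.K) 0 (SU N)))

open Classical in
/-- **★★★ (UV₁₃) AT LEVEL `k ≤ K` OF THE RUN `P` AT NODE 00's STAGE-13 RECORD ALONG dag-n11-e's SUPPLY CHAIN: [III] THEOREM 2 KEYED TO THE CHAIN + THE PRINTED BUDGET,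
(2.48) DISCHARGED** — §1 with the carrier's term values := the chain's OWN witness `(chainWitness θ P σ k).1 s` (no existential seam between the slot and Theorem 2's terms),
the two keyed tokens PRODUCED from `B14.Thm2Printed H033 (sect2DataOfRecord₁₃Keyed θ P (chain witness) 𝒰) L β κ₀` (`∃ E₁ R₁ ≥ 0`, dag-n11-w2's
`exists_nonneg_constants_of_thm2Printed_keyed`; `0 < β < 1`, `1 < L`, `κ₀ ≥ 7`, `H033` at the run's flow, `g_j ≥ 0`), and the (2.48) binder `h248` of §1 DISCHARGED at every `V`
along the chain by dag-n11-w2's `h248_chainWitness_of_chainFormAt` over dag-n11-e's `chainFormAt_all_of_obligations`: rows = def-T's provisos (THE DATUM's OWN `h`), the live selector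
`hsel`, admissibility `hθ`, signs `hE₀ ∕ hB₀`, `1 ≤ M`, `κ₀(4·2^d,2d) ≤ κ`, the supply chain's obligations `(hσ, hT)`, the (2.41)(ii)-regular class `h𝒰`, ring volumes `hΓr`;
`B₁ := θ.s2.lf.B₀·K₀(4·2^d,2d)`.  Still displayed: `hU`, `hφ ∕ hφ1`, `hβj`, `hΓvol ∕ hΓr ∕ hΓ`, `hsum`, `hvac`, `hlog ∕ hlog'`, the seam `hA'eq` (chain's term values),
`0 ≤ 1 + 2B₁ + E₂`, budget data, (1.90) gas, `hH`.  Conclusion: `∃ E₁ R₁ ≥ 0` such that (2.46)'s `R₁`-SMALLNESS (displayed guard `∀ n ≤ k, R₁ g_n^{κ₀−6} ≤ 1`) implies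
`B16.UVIneq ((datumOfRecord₁₃CoPH F N θ h).C P) k V E₋ E₊` at EVERY `V`.  CONDITIONAL on every input — LOCATED as §1; [III] Theorems 1 ∕ 2 ∕ Cor. 3 NOT proved (Theorem 2 keyed
and the obligations are HYPOTHESES); nothing of Bałaban's asserted; N11 ∕ N13 NOT discharged; count-neutral.
[cite: Balaban1988Convergent, Thm 1 p.262, Thm 2 p.263, (2.41)–(2.42) p.261, (2.45)–(2.50) pp.263–264; Balaban1989LargeFieldII, (0.1) p.356, (1.72) p.379, (1.80) p.384, p.387 ll.21–27, p.391] -/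
theorem uvIneq_at_record₁₃CoPH_of_thm2Printed_chainWitness_of_obligations_of_fullBudget (Nc : ℕ) [NeZero Nc] (R : Repr172 (GaugeField (F.P P.K) k (SU N)) (tsys 4 Nc).Dom)
    {M₁ : ℝ} (hM : M₁ ≠ 0) (hnum : (Fintype.card (Site (F.P P.K) k) : ℝ) = (M₁ * Nc) ^ 4)
    {κ₁ : ℝ} (hκ : B12TreeDecay.kappa₀ (4 * 2 ^ 4) (2 * 4) ≤ κ₁) (hκ₁ : 0 ≤ κ₁) (c₀ : ℝ)
    (hH : R.Holds (densOfRecord₁₃ F N θ.toStage13Params P k))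
    (hχ01 : ∀ a V, 0 ≤ R.χ a V ∧ R.χ a V ≤ 1)
    (h0χ : ∀ V, R.χ R.allSmall V = chiβOfRecord₁₃ F N θ.toStage13Params P.K (gOfRecord₁₃ F N θ.toStage13Params P) k V)
    -- the components of `Z_k`: composite structure and per-component (1.79)/(1.80) data
    (T : R.Adm → (tsys 4 Nc).Dom → PosOp (GaugeField (F.P P.K) k (SU N))) (l : R.Adm → List (tsys 4 Nc).Dom)
    (hnd : ∀ a, (l a).Nodup) (hset : ∀ a, (l a).toFinset = R.Zc a)
    (hTZ : ∀ a Fn V, (R.TZ a).T Fn V = (PosOp.pi (T a) (l a)).T Fn V)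
    (b : Step.Budget.Consts) (Lb : ℝ) {Rk q : ℕ} (hRk : 0 < Rk) (hq : 0 < q)
    (hC : 0 ≤ b.C) (hbM : 0 ≤ b.M) (hRm : ∀ m, 0 ≤ b.R m) (hdim : b.d = 4) (hRq : ((Rk * q : ℕ) : ℝ) = Lb * b.R (k + 1)) (hLb : 0 ≤ Lb)
    (hslope2 : 2 * (κ₁ * (4 * 2 ^ 4) * Lb ^ b.d) ≤ b.C * b.M ^ b.d * b.R (k + 1))
    (X₀ : R.Adm → (tsys 4 Nc).Dom → Finset (Pt 4)) (K : R.Adm → (tsys 4 Nc).Dom → ℕ)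
    (κ Pp : R.Adm → (tsys 4 Nc).Dom → ℝ) (s : R.Adm → (tsys 4 Nc).Dom → ℕ → ℝ)
    (hdataZ : ∀ a, ∀ X ∈ R.Zc a, (X₀ a X).Nonempty ∧ FaceConnected (X₀ a X) ∧
      X.1 = (fineCubes Rk (X₀ a X)).image (proj Nc) ∧ 1 ≤ K a X ∧
      (∀ V, (T a X).T 1 V ≤ Real.exp (-(κ a X) - Pp a X)) ∧ Step.Budget.Controls b k (K a X) (κ a X) (s a X) ∧
      (∀ m, 0 ≤ s a X m) ∧ s a X (k + 1) = treeLen (Sop q (X₀ a X)) ∧ c₀ ≤ Pp a X)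
    -- the domains `Y_i`: composite structure and per-domain (1.80)⁺ horizon-0 data
    (TY : R.Adm → (tsys 4 Nc).Dom → PosOp (GaugeField (F.P P.K) k (SU N))) (lY : R.Adm → List (tsys 4 Nc).Dom)
    (hndY : ∀ a, (lY a).Nodup) (hsetY : ∀ a, (lY a).toFinset = R.Ys a)
    (hTYs : ∀ a Fn V, (R.TYs a).T Fn V = (PosOp.pi (TY a) (lY a)).T Fn V)
    (SY : R.Adm → (tsys 4 Nc).Dom → Finset (Pt 4)) (κY PY : R.Adm → (tsys 4 Nc).Dom → ℝ) (sY : R.Adm → (tsys 4 Nc).Dom → ℕ → ℝ)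
    (hdataY : ∀ a, ∀ Y ∈ R.Ys a, (SY a Y).Nonempty ∧ FaceConnected (SY a Y) ∧
      Y.1 = (fineCubes Rk (SY a Y)).image (proj Nc) ∧ (∀ V, (TY a Y).T 1 V ≤ Real.exp (-(κY a Y) - PY a Y)) ∧
      Step.Budget.Controls b k 0 (κY a Y - κ₁ * treeLen (fineCubes Rk (SY a Y))) (sY a Y) ∧ c₀ ≤ PY a Y)
    -- the (1.90) gas of every admissible term (verbatim)
    {LF DomY Cube Var Sv : Type*} [Fintype LF] [Fintype DomY] [Fintype Cube] [DecidableEq LF] [DecidableEq DomY]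
    [DecidableEq Cube] {adjC : Cube → Cube → Prop} [DecidableRel adjC]
    (hrefl : ∀ a, adjC a a) (hsymm : ∀ a b, adjC a b → adjC b a)
    {locX : LF → Finset Cube} {locY : DomY → Finset Cube} {site : Var → Cube} (Yfix : R.Adm → Finset Cube)
    (houtX : ∀ a j, (locX j \ Yfix a).Nonempty) (houtY : ∀ a Y, (locY Y \ Yfix a).Nonempty)
    (Op : R.Adm → Finset LF → ((Var → Sv) → ℂ) →+ ((Var → Sv) → ℂ))
    (hOps : ∀ a, LocalOps adjC locX (Yfix a) site (Op a))
    (hOpReal : ∀ a (S : Finset LF) (f : (Var → Sv) → ℂ), (∀ ψ, (f ψ).im = 0) → ∀ φ, (Op a S f φ).im = 0)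
    (Vt : R.Adm → DomY → (Var → Sv) → ℂ) (hV : ∀ a Y, DepOn (Yfix a) site (Vt a Y) (locY Y))
    (hVreal : ∀ a Y ψ, (Vt a Y ψ).im = 0) (cfg : GaugeField (F.P P.K) k (SU N) → (Var → Sv))
    {nbr : Cube → Finset Cube} (hnbr : ∀ a b, adjC a b → a ∈ nbr b) {νn : ℝ} (hν : ∀ b, ((nbr b).card : ℝ) ≤ νn)
    {d : R.Adm → Finset Cube → ℝ} {c₁ Rr κc K₀ cv τ : ℝ} (hd : ∀ a X, 0 ≤ d a X) (hc₁ : 0 ≤ c₁) (hK₀ : 0 ≤ K₀) (hτ : 0 ≤ τ)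
    (h197 : ∀ a V X, ‖F191 adjC locX locY (Yfix a) (mayerTerm (Op a) (Vt a) (cfg V)) X‖ ≤ c₁ * Real.exp (-(Rr * d a X)))
    (h126 : ∀ a, Ineq126 (polys190 adjC locX locY (Yfix a)) (fun X => X \ Yfix a) (d a) κc K₀)
    (hvol : ∀ a, VolBound (polys190 adjC locX locY (Yfix a)) (fun X => X \ Yfix a) (d a) cv)
    (hrate : κc + τ * cv ≤ Rr) (hsmall : c₁ * Real.exp (τ * cv) * K₀ * νn ≤ τ)
    (hjunction : ∀ a V, R.curly a V = (bracket (Op a) (Vt a) (cfg V)).re)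
    {πc : ℝ} (hQ : (Fintype.card Cube : ℝ) ≤ πc * (Fintype.card (Site (F.P P.K) k) : ℝ))
    -- dag-n11-e's supply chain on the live-selector line and [III] Theorem 2 KEYED TO THE CHAIN at the class `𝒰`
    (σ : Sect3Supplier θ P)
    (hsel : θ.ppSel = ppSelLiveOfRecord F N θ.ν θ.τ9 (EOfRecord₁₃ F N θ.toStage13Params) (wOfRecord₉ F N θ.toStage9Params))
    (hθ : θ.Admissible F N) (hE₀ : 0 ≤ θ.s2.lf.E₀) (hB₀ : 0 ≤ θ.s2.lf.B₀) (hMτ : 1 ≤ θ.τ9.M)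
    (hκd : B12TreeDecay.kappa₀ (4 * 2 ^ (F.P P.K).d) (2 * (F.P P.K).d) ≤ θ.s2.lf.κ)
    (hσ : SupplierObligations θ P σ) (hT : NoExpansionObligation θ P σ)
    (H033 : Flow → ℕ → Prop) {L β : ℝ} {κ₀ : ℕ}
    (hT2 : B14.Thm2Printed H033 (fun _ : PUnit => sect2DataOfRecord₁₃Keyed θ P (fun k s => (chainWitness θ P σ k).1 s) 𝒰) L β κ₀)
    (hβ1 : β < 1) (hβ0 : 0 < β) (hL : 1 < L) (hκ7 : 7 ≤ κ₀)
    (h033 : H033 (flowOfRun (gOfRecord₁₃ F N θ.toStage13Params P)) P.K) (hg : ∀ j, j ≤ P.K → 0 ≤ gOfRecord₁₃ F N θ.toStage13Params P j)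
    (h𝒰 : ∀ k (s : SeqOfRecord F θ.ν θ.τ9.M (gOfRecord₁₃ F N θ.toStage13Params P) P.K k) (U : GaugeField (F.P P.K) 0 (SU N)), U ∈ 𝒰 k s →
      ∀ j, 1 ≤ j → j ≤ k → ∀ X, Sect2.admB (F.P P.K) θ.ν θ.τ9.M (gOfRecord₁₃ F N θ.toStage13Params P) s.Ω s.Λ j (Sect2.domSites (F.P P.K) θ.τ9.M j X) = true →
        Sect2.ofBackgroundC (ιSU N) U ∈ Sect2.spaceMS (settingOfRecord₁₃ F N θ.toStage13Params P) (θ.rzAt P s) θ.τ9.M j (Sect2.domSites (F.P P.K) θ.τ9.M j X) s.Ω)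
    (hk : k ≤ P.K)
    -- the configuration-indexed data READ THROUGH THE CARRIER: history, membership of `U_k(V)`, fluctuation argument, volumes (region and ring)
    (sV : (V : GaugeField (F.P P.K) k (SU N)) → SeqOfRecord F θ.ν θ.τ9.M (gOfRecord₁₃ F N θ.toStage13Params P) P.K k)
    (hU : ∀ V, Uk F N P.K k θ.εbg V ∈ 𝒰 k (sV V))
    (aV : GaugeField (F.P P.K) k (SU N) → Tk.SFluct (F.P P.K) (FluctV N))
    (Ek EkLog EkRest : ℝ) (hEk : Ek = EkLog + EkRest) (E₂ : ℝ) (Γ : ℕ → ℝ)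
    (hΓvol : ∀ V, ∀ n, 1 ≤ n → n ≤ k → ((univ.filter fun y : Site (F.P P.K) n => toFine n y ∈ gammaRegion (sV V).Ω k n).card : ℝ) ≤ Γ n)
    (hΓr : ∀ V, ∀ n, 1 ≤ n → n ≤ k →
      ((univ.filter fun c : TPt (F.P P.K).d (Sect2.domCount (F.P P.K) θ.τ9.M n) =>
          (Sect2.domSites (F.P P.K) θ.τ9.M n (Sect2.cubeDom (F.P P.K) θ.τ9.M n c) ∩
              Sect2.enlT (F.P P.K) (Sect2.zSide (F.P P.K) θ.ν θ.τ9.M (gOfRecord₁₃ F N θ.toStage13Params P) n) 1 ((sV V).Λ n)ᶜ).Nonempty ∧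
            ∃ c', (c' = c ∨ TAdj c' c) ∧ (Sect2.domSites (F.P P.K) θ.τ9.M n (Sect2.cubeDom (F.P P.K) θ.τ9.M n c') ∩ (sV V).Ω n).Nonempty).card : ℝ) ≤ Γ n)
    (hβj : ∀ j, 1 ≤ j → j ≤ k → 0 ≤ 1 / gOfRecord₁₃ F N θ.toStage13Params P (j - 1) ^ 2 - 1 / gOfRecord₁₃ F N θ.toStage13Params P j ^ 2)
    (hφ : ∀ V, ∀ j, 1 ≤ j → j ≤ k → ∀ x, θ.Phih P k (sV V).Ω (sV V).Λ j x ≤ 1)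
    (hφ1 : ∀ V, chiβOfRecord₁₃ F N θ.toStage13Params P.K (gOfRecord₁₃ F N θ.toStage13Params P) k V ≠ 0 →
      ∀ j, 1 ≤ j → j ≤ k → ∀ x, θ.Phih P k (sV V).Ω (sV V).Λ j x = 1)
    (hsum : ∀ n, 1 ≤ n → n ≤ k → ∑ j ∈ Icc 1 n, (gOfRecord₁₃ F N θ.toStage13Params P j) ^ κ₀ ≤ (gOfRecord₁₃ F N θ.toStage13Params P n) ^ (κ₀ - 6))
    (hvac : VacuumRestBound EkRest E₂ Γ k)
    (hA'eq : ∀ V, R.A' V =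
      (sect2ActionDataOfRecord F N (FluctV N) P.K (settingOfRecord₁₃ F N θ.toStage13Params P) (θ.rzAt P (sV V)) (sV V)
        ((chainWitness θ P σ k).1 (sV V)) (aV V) Ek).action23 k (Uk F N P.K k θ.εbg V))
    -- the sizes of the logarithmic vacuum term, the volume majorant, the sign of the `E₁`-free part of Theorem 2's constant
    {cΓ cL cL' : ℝ} (hrest : 0 ≤ 1 + 2 * (θ.s2.lf.B₀ * B12TreeDecay.K₀ (4 * 2 ^ (F.P P.K).d) (2 * (F.P P.K).d)) + E₂)
    (hΓ : ∑ n ∈ Icc 1 k, Γ n ≤ cΓ * (Fintype.card (Site (F.P P.K) k) : ℝ))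
    (hlog : -(cL * (Fintype.card (Site (F.P P.K) k) : ℝ)) ≤ -EkLog)
    (hlog' : -EkLog ≤ cL' * (Fintype.card (Site (F.P P.K) k) : ℝ)) :
    ∃ E₁ R₁ : ℝ, 0 ≤ E₁ ∧ 0 ≤ R₁ ∧
      ((∀ n, 1 ≤ n → n ≤ k → R₁ * (gOfRecord₁₃ F N θ.toStage13Params P n) ^ (κ₀ - 6) ≤ 1) →
        ∀ V : GaugeField (F.P P.K) k (SU N),
          B16.UVIneq ((datumOfRecord₁₃CoPH F N θ h).C P) k V
            ((E₁ * (1 - L ^ (-β))⁻¹ + 1 + 2 * (θ.s2.lf.B₀ * B12TreeDecay.K₀ (4 * 2 ^ (F.P P.K).d) (2 * (F.P P.K).d)) + E₂) * cΓ + cL +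
              πc * (c₁ * Real.exp (τ * cv) * K₀))
            ((E₁ * (1 - L ^ (-β))⁻¹ + 1 + 2 * (θ.s2.lf.B₀ * B12TreeDecay.K₀ (4 * 2 ^ (F.P P.K).d) (2 * (F.P P.K).d)) + E₂) * cΓ + cL' +
              πc * (c₁ * Real.exp (τ * cv) * K₀) + M₁⁻¹ ^ 4 * B12TreeDecay.K₀ (4 * 2 ^ 4) (2 * 4) * ∑ _i : Fin 2, Real.exp (-c₀))) := by
  have hκ0 : 0 ≤ θ.s2.lf.κ := (B12TreeDecay.kappa₀_nonneg (by positivity) _).trans hκd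
  obtain ⟨E₁, R₁, hE, hR, h243K, h244K⟩ := exists_nonneg_constants_of_thm2Printed_keyed θ P (fun k s => (chainWitness θ P σ k).1 s) 𝒰 H033 hT2 hβ1
    h033 (le_of_lt (lt_trans zero_lt_one hL)) hg
  refine ⟨E₁, R₁, hE, hR, fun hsmall6 => ?_⟩
  have hkmK : k ≤ (F.P P.K).m + (F.P P.K).K := by rw [T4Family.P_K]; omega
  have hform : ChainFormAt θ P σ k := chainFormAt_all_of_obligations h hsel hθ hκ0 hE₀ hB₀ hMτ σ hσ hT k hk
  have h248 : ∀ V : GaugeField (F.P P.K) k (SU N),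
      |B240 (sect2TowerOfRecord F N (FluctV N) P.K (settingOfRecord₁₃ F N θ.toStage13Params P) (θ.rzAt P (sV V)) (sV V) ((chainWitness θ P σ k).1 (sV V)))
        (fun j X => Sect2.admB (F.P P.K) θ.ν θ.τ9.M (gOfRecord₁₃ F N θ.toStage13Params P) (sV V).Ω (sV V).Λ j (Sect2.domSites (F.P P.K) θ.τ9.M j X)) (aV V) k
        (Uk F N P.K k θ.εbg V)| ≤ 2 * (θ.s2.lf.B₀ * B12TreeDecay.K₀ (4 * 2 ^ (F.P P.K).d) (2 * (F.P P.K).d)) * ∑ n ∈ Icc 1 k, Γ n := fun V =>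
    h248_chainWitness_of_chainFormAt θ P σ hform (sV V) (aV V) (Uk F N P.K k θ.εbg V) hkmK hMτ hκd hB₀ (h𝒰 k (sV V) (Uk F N P.K k θ.εbg V) (hU V)) Γ (hΓr V)
  have hCA : 0 ≤ E₁ * (1 - L ^ (-β))⁻¹ + 1 + 2 * (θ.s2.lf.B₀ * B12TreeDecay.K₀ (4 * 2 ^ (F.P P.K).d) (2 * (F.P P.K).d)) + E₂ := cA_nonneg hE hL hβ0 hrest
  exact uvIneq_at_record₁₃CoPH_of_ineq243_ineq244_keyed_of_fullBudget F N θ h P k (fun k s => (chainWitness θ P σ k).1 s) 𝒰 Nc R hM hnum hκ hκ₁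
    c₀ hH hχ01 h0χ T l hnd hset hTZ b Lb hRk hq hC hbM hRm hdim hRq hLb hslope2 X₀ K κ Pp s hdataZ TY lY hndY hsetY hTYs SY κY PY sY hdataY
    hrefl hsymm Yfix houtX houtY Op hOps hOpReal Vt hV hVreal cfg hnbr hν hd hc₁ hK₀ hτ h197 h126 hvol hrate hsmall hjunction hQ h243K h244K hL
    hβ0 hE hR hκ7 hk hg sV hU aV Ek EkLog EkRest hEk (θ.s2.lf.B₀ * B12TreeDecay.K₀ (4 * 2 ^ (F.P P.K).d) (2 * (F.P P.K).d)) E₂ Γ hΓvol hβj hφ hφ1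
    hsum hsmall6 h248 hvac hA'eq hCA hΓ hlog hlog'

end ChainEnd

end Summit.QuantumFields.YangMills.BalabanUVNodes.N13Cor3AsymJunctionThm2KeyedFullBudgetAtRecord13CoPH

end
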